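import Summits.QuantumFields.YangMills.Theorems.UnitScaleTiltProp7LapCombFirstOrder
import Summits.QuantumFields.YangMills.Theorems.UnitScaleTiltProp7RungDifferenceLocal
import HarnessLib

/-!
# Route `UnitScaleTilt`, crux K1 «MinimiserStabilityRegPr» (stmt-QuantumFields-19200), route-R E′, S3 K-form engine, ROW (H) — hLap INHABITANT, FILE E (ℤ^d comb letters):
# THE LAPLACIAN SUMMAND OF A COMB LOCAL MODEL IN LOCAL FORM — `2m − R(V(contour at w))⁻¹m − R(V(contour at w+e_μ))m = −[Σ_k 𝒯(p_k)(P₁(k) − R(V(p_k−e_μ,μ)⁻¹)P₂(k))𝒯(p_k)⁻¹, m]`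
# up to `15·a·|B|`× the two canonical rung families: ✓ `Prop7LapCombFirstOrder` (first order, canonical transports) ∘ ✓ `Prop7RungDifferenceLocal` (localisation) with the
# JACOBI junk BOOKED — the transport loop `G_k = 𝒯(p_k)⁻¹𝒯(p_k−e_μ)V(p_k−e_μ,μ)` IS the conjugated second ladder, so `‖G_k − 1‖ ≤ k·a` and its commutator is a rung-family sum

Cell `ym3-torus`, width seat `ym3-torus-px4` (gen 4); ★ym-ust-19200-p1 g16 NAMER WORD 14 «px4 g4: hLap INHABITANT GO» (2026-08-29 00:17Z), road (iii).  THEOREMS ONLY (0 `def`,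
0 `sorry`); `--supports stmt-QuantumFields-19200`, count-neutral.  YM₃ on T³ is a ladder rung (R3), not the Clay problem; nothing here claims hLap, hRes, (H), S3, E′, a stub,
the crux, d = 4 or the mass gap.

WHAT IS PROVED (ns `…Theorems.Prop7LapCombLocal`; letters of ✓ `Prop7LapCombFirstOrder.norm_lapDefect_comb_add_comm_sum_le`: split `s ++ μ :: t`, site `w`, tail `B`, bases `q₁`
(contour at `w + e_μ`), `q₂ = q₁ − e_μ` (contour at `w`), rung points `p_k = q₁ + disp(B↾k)`, comb transports `𝒯(p) = V(Γ_(0,p))`).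
* §1 (any group) ★ `ladder_eq_transport_loop` (`V_(q₂)(ladder_μ W) = V_(q₂)(W)·V(q₂ + disp W, μ)·V_(q₂+e_μ)(W)⁻¹·V(q₂,μ)⁻¹`), `transport_loop_eq_conj_ladder`
  (`V_(q₁)(W)⁻¹·V(q₂,μ)⁻¹·V_(q₂)(W)·V(q₂ + disp W, μ) = U·V_(q₂)(ladder_μ W)·U⁻¹`, `U = V_(q₁)(W)⁻¹V(q₂,μ)⁻¹`).
* §2 (normed) ★★★ `norm_lapDefect_comb_add_comm_local_le` — under `a·|B| ≤ 1` (one decl-local `maxHeartbeats 400000`, README budget rule: passes at 200k, not at 100k):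
  `‖(2m − R(V(contour27 0 w μ))⁻¹m − R(V(contour27 0 (w+e_μ) μ))m) + [Σ_(k<|B|) 𝒯(p_k)(P₁(k) − V(p_k−e_μ,μ)⁻¹P₂(k)V(p_k−e_μ,μ))𝒯(p_k)⁻¹, m]‖ ≤ 15·a·|B|·(Σ_k N₁(k) + Σ_k N₂(k))` —
  the first-order term is now the commutator with the transported LOCAL covariant curvature differences (the pair of ✓ `Prop7CurrentConjugationDefect` at each tail point), ready
  for ✓ `Prop7LapCombRegroup` (sum over `μ`, regroup by site: the current letter at last-run sites).
HONEST SCOPE.  Word algebra + the cited inequalities; no count over `w`, no `Σ_μ`, no T³.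

References: T. Bałaban, CMP 99 (1985) 75–102 [Balaban1985RegularSpaces] ((1.1)–(1.2) p.76, (1.9) p.77); CMP 98 (1985) 17–51 [Balaban1985Averaging] ((9) pp.18–19,
(19)–(20) p.21, p.24); CMP 99 (1985) 389–434 [Balaban1985BackgroundPropagators] ((3.3)–(3.4) pp.390–391, (3.8)–(3.9) p.392); CMP 102 (1985) 255–275 [Balaban1985UV3] ((27) p.263).
-/

set_option autoImplicit false

noncomputable section

open scoped BigOperators

namespace Summit.QuantumFields.YangMills.Theorems.Prop7LapCombLocal

open Literature.MathematicalPhysics.QuantumFieldTheory.Balaban1983to89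
open B7Prop1Explicit (Site Letter e disp revWord seg treeWord hol stepHol hol_append hol_cons hol_nil stepHol_false disp_append disp_cons disp_nil disp_revWord hol_revWord')
open B10Eq27AxialLog (contour27)
open B9Eq39Adjoint (R R_def)
open Summit.QuantumFields.YangMills.Theorems.Prop7CombLadder (flatMap_seg_add_e bicontr_hol bicontr_conj)
open Summit.QuantumFields.YangMills.Theorems.Prop7CombLadderCount (disp_base_neg disp_base_nonneg)
open Summit.QuantumFields.YangMills.Theorems.Prop7CombLoopSquareCount (hol_base_prefix_nonneg)
open Summit.QuantumFields.YangMills.Theorems.Prop7CommutatorChain (comm_chain_le comm_conj_le comm_le_comm_add norm_R_inv_sub_self_le_comm_of_inv)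
open Summit.QuantumFields.YangMills.Theorems.Prop7DoubleCommutatorChain (norm_conj_sub_one_le)
open Summit.QuantumFields.YangMills.Theorems.Prop7LapDefectFirstOrder (norm_chain_sub_one_le)
open Summit.QuantumFields.YangMills.Theorems.Prop7RungDifferenceLocal (comm_sum_rung_sub_sum_local_le)
open Summit.QuantumFields.YangMills.Theorems.Prop7LapCombFirstOrder (hol_prefix_pred ladder_chain_zero ladder_chain_succ norm_lapDefect_comb_add_comm_sum_le)
open B16Txt357ThirdOrderNonAbelian (norm_R_le)

/-! ## §1 The transport loop of the localisation is the conjugated second ladder (any group) -/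

section Group

variable {d : ℕ} {G : Type*} [Group G] (V : Site d → Fin d → G)

/-- ★ **THE LADDER AS A TRANSPORT LOOP**: `V_(q₂)(W ++ μ ++ W̄ ++ μ̄) = V_(q₂)(W)·V(q₂ + disp W, μ)·V_(q₂+e_μ)(W)⁻¹·V(q₂, μ)⁻¹`. [cite: Balaban1985Averaging, (9) pp.18-19] -/
theorem ladder_eq_transport_loop (q₂ : Site d) (μ : Fin d) (W : List (Letter d)) :
    hol V q₂ (W ++ (μ, true) :: (revWord W ++ [(μ, false)])) = hol V q₂ W * V (q₂ + disp W) μ * (hol V (q₂ + e μ) W)⁻¹ * (V q₂ μ)⁻¹ := by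
  rw [hol_append, hol_cons, B7Prop1Explicit.stepHol_true, Letter.vec_true, hol_append,
    hol_revWord' V (q₂ + disp W + e μ) W (by abel : q₂ + disp W + e μ = (q₂ + e μ) + disp W), disp_revWord, hol_cons, hol_nil, mul_one, stepHol_false,
    show q₂ + disp W + e μ + -disp W - e μ = q₂ by abel]
  group

/-- **THE TRANSPORT LOOP OF THE LOCALISATION IS THE CONJUGATED LADDER**: `V_(q₂+e_μ)(W)⁻¹·V(q₂,μ)⁻¹·V_(q₂)(W)·V(q₂ + disp W, μ) = U·V_(q₂)(ladder_μ W)·U⁻¹`, `U = V_(q₂+e_μ)(W)⁻¹·V(q₂,μ)⁻¹`.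
[cite: Balaban1985Averaging, (9) pp.18-19; Balaban1985RegularSpaces, (1.1)-(1.2) p.76] -/
theorem transport_loop_eq_conj_ladder (q₂ : Site d) (μ : Fin d) (W : List (Letter d)) :
    (hol V (q₂ + e μ) W)⁻¹ * (V q₂ μ)⁻¹ * hol V q₂ W * V (q₂ + disp W) μ
      = ((hol V (q₂ + e μ) W)⁻¹ * (V q₂ μ)⁻¹) * hol V q₂ (W ++ (μ, true) :: (revWord W ++ [(μ, false)])) * ((hol V (q₂ + e μ) W)⁻¹ * (V q₂ μ)⁻¹)⁻¹ := by
  rw [ladder_eq_transport_loop]; group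

end Group

/-! ## §2 The local form with the Jacobi junk booked -/

section Normed

variable {d : ℕ} {𝔸 : Type*} [NormedRing 𝔸] [NormOneClass 𝔸] (V : Site d → Fin d → 𝔸ˣ)
  (hV : ∀ (x : Site d) (κ : Fin d), ‖(V x κ : 𝔸)‖ ≤ 1 ∧ ‖(((V x κ)⁻¹ : 𝔸ˣ) : 𝔸)‖ ≤ 1)

include hV in
set_option maxHeartbeats 400000 in
/-- ★★★ **THE LAPLACIAN SUMMAND OF A COMB LOCAL MODEL, LOCAL FORM** (letters of ✓ `norm_lapDefect_comb_add_comm_sum_le`; `p_k = q₁ + disp(B↾k)`, `p_k − e_μ = q₂ + disp(B↾k)`).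
If every plaquette word is within `a ≥ 0` of `1` and `a·|B| ≤ 1`, then
`‖(2m − R(V(contour27 0 w μ))⁻¹m − R(V(contour27 0 (w+e_μ) μ))m) + [Σ_(k<|B|) 𝒯(p_k)·(P₁(k) − V(p_k−e_μ,μ)⁻¹·P₂(k)·V(p_k−e_μ,μ))·𝒯(p_k)⁻¹, m]‖ ≤ 15·a·|B|·(Σ_k N₁(k) + Σ_k N₂(k))` —
first order: the commutator with the comb-transported LOCAL covariant curvature differences along the tail; junk: `a·|B|`× the two canonical rung families.
[cite: Balaban1985RegularSpaces, (1.1)-(1.2) p.76, (1.9) p.77; Balaban1985BackgroundPropagators, (3.3)-(3.4) pp.390-391, (3.8)-(3.9) p.392; Balaban1985Averaging, (9) pp.18-19, (19)-(20) p.21, p.24] -/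
theorem norm_lapDefect_comb_add_comm_local_le (μ : Fin d) {s t : List (Fin d)} (h : (List.finRange d).reverse = s ++ μ :: t) (hs : μ ∉ s) (ht : μ ∉ t)
    (w : Site d) (m : 𝔸) {a : ℝ} (ha : 0 ≤ a) (hplaq : ∀ (x : Site d) (l : Letter d), ‖((hol V x [l, (μ, true), l.rev, (μ, false)] : 𝔸ˣ) : 𝔸) - 1‖ ≤ a)
    (han : a * (t.flatMap (fun κ => seg κ (w κ))).length ≤ 1) :
    ‖((2 : ℕ) • m - R (hol V 0 (contour27 0 w μ))⁻¹ m - R (hol V 0 (contour27 0 (w + e μ) μ)) m)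
        + ((∑ k ∈ Finset.range (t.flatMap (fun κ => seg κ (w κ))).length,
              ((hol V 0 (treeWord (disp (s.flatMap (fun κ => seg κ (w κ)) ++ seg μ (w μ + 1)) + disp ((t.flatMap (fun κ => seg κ (w κ))).take k))) : 𝔸ˣ) : 𝔸)
                * (((hol V (disp (s.flatMap (fun κ => seg κ (w κ)) ++ seg μ (w μ + 1)) + disp ((t.flatMap (fun κ => seg κ (w κ))).take k))
                      [(t.flatMap (fun κ => seg κ (w κ))).getD k (μ, true), (μ, true), ((t.flatMap (fun κ => seg κ (w κ))).getD k (μ, true)).rev, (μ, false)] : 𝔸ˣ) : 𝔸)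
                  - (((V (disp (s.flatMap (fun κ => seg κ (w κ)) ++ seg μ (w μ)) + disp ((t.flatMap (fun κ => seg κ (w κ))).take k)) μ)⁻¹
                      * hol V (disp (s.flatMap (fun κ => seg κ (w κ)) ++ seg μ (w μ)) + disp ((t.flatMap (fun κ => seg κ (w κ))).take k))
                          [(t.flatMap (fun κ => seg κ (w κ))).getD k (μ, true), (μ, true), ((t.flatMap (fun κ => seg κ (w κ))).getD k (μ, true)).rev, (μ, false)]
                      * ((V (disp (s.flatMap (fun κ => seg κ (w κ)) ++ seg μ (w μ)) + disp ((t.flatMap (fun κ => seg κ (w κ))).take k)) μ)⁻¹)⁻¹ : 𝔸ˣ) : 𝔸))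
                * ((((hol V 0 (treeWord (disp (s.flatMap (fun κ => seg κ (w κ)) ++ seg μ (w μ + 1)) + disp ((t.flatMap (fun κ => seg κ (w κ))).take k))))⁻¹ : 𝔸ˣ) : 𝔸))) * m
          - m * ∑ k ∈ Finset.range (t.flatMap (fun κ => seg κ (w κ))).length,
              ((hol V 0 (treeWord (disp (s.flatMap (fun κ => seg κ (w κ)) ++ seg μ (w μ + 1)) + disp ((t.flatMap (fun κ => seg κ (w κ))).take k))) : 𝔸ˣ) : 𝔸)
                * (((hol V (disp (s.flatMap (fun κ => seg κ (w κ)) ++ seg μ (w μ + 1)) + disp ((t.flatMap (fun κ => seg κ (w κ))).take k))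
                      [(t.flatMap (fun κ => seg κ (w κ))).getD k (μ, true), (μ, true), ((t.flatMap (fun κ => seg κ (w κ))).getD k (μ, true)).rev, (μ, false)] : 𝔸ˣ) : 𝔸)
                  - (((V (disp (s.flatMap (fun κ => seg κ (w κ)) ++ seg μ (w μ)) + disp ((t.flatMap (fun κ => seg κ (w κ))).take k)) μ)⁻¹
                      * hol V (disp (s.flatMap (fun κ => seg κ (w κ)) ++ seg μ (w μ)) + disp ((t.flatMap (fun κ => seg κ (w κ))).take k))
                          [(t.flatMap (fun κ => seg κ (w κ))).getD k (μ, true), (μ, true), ((t.flatMap (fun κ => seg κ (w κ))).getD k (μ, true)).rev, (μ, false)]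
                      * ((V (disp (s.flatMap (fun κ => seg κ (w κ)) ++ seg μ (w μ)) + disp ((t.flatMap (fun κ => seg κ (w κ))).take k)) μ)⁻¹)⁻¹ : 𝔸ˣ) : 𝔸))
                * ((((hol V 0 (treeWord (disp (s.flatMap (fun κ => seg κ (w κ)) ++ seg μ (w μ + 1)) + disp ((t.flatMap (fun κ => seg κ (w κ))).take k))))⁻¹ : 𝔸ˣ) : 𝔸)))‖
      ≤ 15 * a * (t.flatMap (fun κ => seg κ (w κ))).length
          * (∑ k ∈ Finset.range (t.flatMap (fun κ => seg κ (w κ))).length,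
                ‖((hol V (disp (s.flatMap (fun κ => seg κ (w κ)) ++ seg μ (w μ + 1)) + disp ((t.flatMap (fun κ => seg κ (w κ))).take k))
                      [(t.flatMap (fun κ => seg κ (w κ))).getD k (μ, true), (μ, true), ((t.flatMap (fun κ => seg κ (w κ))).getD k (μ, true)).rev, (μ, false)] : 𝔸ˣ) : 𝔸)
                    * R (hol V 0 (treeWord (disp (s.flatMap (fun κ => seg κ (w κ)) ++ seg μ (w μ + 1)) + disp ((t.flatMap (fun κ => seg κ (w κ))).take k))))⁻¹ m
                  - R (hol V 0 (treeWord (disp (s.flatMap (fun κ => seg κ (w κ)) ++ seg μ (w μ + 1)) + disp ((t.flatMap (fun κ => seg κ (w κ))).take k))))⁻¹ m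
                    * ((hol V (disp (s.flatMap (fun κ => seg κ (w κ)) ++ seg μ (w μ + 1)) + disp ((t.flatMap (fun κ => seg κ (w κ))).take k))
                      [(t.flatMap (fun κ => seg κ (w κ))).getD k (μ, true), (μ, true), ((t.flatMap (fun κ => seg κ (w κ))).getD k (μ, true)).rev, (μ, false)] : 𝔸ˣ) : 𝔸)‖
            + ∑ k ∈ Finset.range (t.flatMap (fun κ => seg κ (w κ))).length,
                ‖((hol V (disp (s.flatMap (fun κ => seg κ (w κ)) ++ seg μ (w μ)) + disp ((t.flatMap (fun κ => seg κ (w κ))).take k))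
                      [(t.flatMap (fun κ => seg κ (w κ))).getD k (μ, true), (μ, true), ((t.flatMap (fun κ => seg κ (w κ))).getD k (μ, true)).rev, (μ, false)] : 𝔸ˣ) : 𝔸)
                    * R (hol V 0 (treeWord (disp (s.flatMap (fun κ => seg κ (w κ)) ++ seg μ (w μ)) + disp ((t.flatMap (fun κ => seg κ (w κ))).take k))))⁻¹ m
                  - R (hol V 0 (treeWord (disp (s.flatMap (fun κ => seg κ (w κ)) ++ seg μ (w μ)) + disp ((t.flatMap (fun κ => seg κ (w κ))).take k))))⁻¹ m
                    * ((hol V (disp (s.flatMap (fun κ => seg κ (w κ)) ++ seg μ (w μ)) + disp ((t.flatMap (fun κ => seg κ (w κ))).take k))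
                      [(t.flatMap (fun κ => seg κ (w κ))).getD k (μ, true), (μ, true), ((t.flatMap (fun κ => seg κ (w κ))).getD k (μ, true)).rev, (μ, false)] : 𝔸ˣ) : 𝔸)‖) := by
  -- names (as in ✓ `norm_lapDefect_comb_add_comm_sum_le`)
  set A : List (Letter d) := s.flatMap (fun κ => seg κ (w κ)) with hA
  set B : List (Letter d) := t.flatMap (fun κ => seg κ (w κ)) with hB
  set n : ℕ := B.length with hn
  set q₁ : Site d := disp (A ++ seg μ (w μ + 1)) with hq₁
  set q₂ : Site d := disp (A ++ seg μ (w μ)) with hq₂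
  set 𝒯₁ : 𝔸ˣ := hol V 0 (A ++ seg μ (w μ + 1)) with h𝒯₁
  set 𝒯₂ : 𝔸ˣ := hol V 0 (A ++ seg μ (w μ)) with h𝒯₂
  set β : 𝔸ˣ := V q₂ μ with hβ
  -- canonical transports, plaquettes, bonds as functions of the rung index
  set T : ℕ → 𝔸ˣ := fun k => hol V 0 (treeWord (q₁ + disp (B.take k))) with hT
  set T' : ℕ → 𝔸ˣ := fun k => hol V 0 (treeWord (q₂ + disp (B.take k))) with hT'
  set P₁ : ℕ → 𝔸ˣ := fun k => hol V (q₁ + disp (B.take k)) [B.getD k (μ, true), (μ, true), (B.getD k (μ, true)).rev, (μ, false)] with hP₁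
  set P₂ : ℕ → 𝔸ˣ := fun k => hol V (q₂ + disp (B.take k)) [B.getD k (μ, true), (μ, true), (B.getD k (μ, true)).rev, (μ, false)] with hP₂
  set b : ℕ → 𝔸ˣ := fun k => (V (q₂ + disp (B.take k)) μ)⁻¹ with hb
  set N₁ : ℕ → ℝ := fun k => ‖(P₁ k : 𝔸) * R (T k)⁻¹ m - R (T k)⁻¹ m * (P₁ k : 𝔸)‖ with hN₁
  set N₂ : ℕ → ℝ := fun k => ‖(P₂ k : 𝔸) * R (T' k)⁻¹ m - R (T' k)⁻¹ m * (P₂ k : 𝔸)‖ with hN₂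
  have hbi := bicontr_hol V hV
  -- bi-contractivity is closed under inverses and products (also ✓ `B9Thm310CommutatorDataOfPlaquettes.bicontr_inv∕_mul`, stated there for a complete normed ℂ-algebra)
  have bicontr_inv : ∀ {u : 𝔸ˣ}, (‖(u : 𝔸)‖ ≤ 1 ∧ ‖((u⁻¹ : 𝔸ˣ) : 𝔸)‖ ≤ 1) → (‖((u⁻¹ : 𝔸ˣ) : 𝔸)‖ ≤ 1 ∧ ‖(((u⁻¹)⁻¹ : 𝔸ˣ) : 𝔸)‖ ≤ 1) :=
    fun hu => by rw [inv_inv]; exact ⟨hu.2, hu.1⟩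
  have bicontr_mul : ∀ {u v : 𝔸ˣ}, (‖(u : 𝔸)‖ ≤ 1 ∧ ‖((u⁻¹ : 𝔸ˣ) : 𝔸)‖ ≤ 1) → (‖(v : 𝔸)‖ ≤ 1 ∧ ‖((v⁻¹ : 𝔸ˣ) : 𝔸)‖ ≤ 1) →
      (‖((u * v : 𝔸ˣ) : 𝔸)‖ ≤ 1 ∧ ‖(((u * v)⁻¹ : 𝔸ˣ) : 𝔸)‖ ≤ 1) := fun {u v} hu hv => by
    refine ⟨?_, ?_⟩
    · rw [Units.val_mul]; exact (norm_mul_le _ _).trans (by nlinarith [hu.1, hv.1, norm_nonneg (u : 𝔸), norm_nonneg (v : 𝔸)])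
    · rw [mul_inv_rev, Units.val_mul]; exact (norm_mul_le _ _).trans (by nlinarith [hu.2, hv.2, norm_nonneg ((u⁻¹ : 𝔸ˣ) : 𝔸), norm_nonneg ((v⁻¹ : 𝔸ˣ) : 𝔸)])
  -- geometry: `A`, `B` at `w + e_μ`; `q₁ − e_μ = q₂`; `𝒯₂ = 𝒯₁β⁻¹`; canonical transports as prefix × tail prefix
  have hAe : s.flatMap (fun κ => seg κ ((w + e μ) κ)) = A := by rw [hA]; exact flatMap_seg_add_e w μ hs
  have hBe : t.flatMap (fun κ => seg κ ((w + e μ) κ)) = B := by rw [hB]; exact flatMap_seg_add_e w μ ht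
  have hμe : (w + e μ) μ = w μ + 1 := by rw [Pi.add_apply, B7Prop1Explicit.e_apply, if_pos rfl]
  have hq₂' : q₁ - e μ = q₂ := by rw [hq₁, hq₂, disp_base_neg, disp_base_nonneg]
  have hq₁' : q₂ + e μ = q₁ := by rw [← hq₂']; abel
  have h𝒯 : 𝒯₂ = 𝒯₁ * β⁻¹ := by rw [h𝒯₂, h𝒯₁, hβ, ← hq₂', hq₁, hA]; exact hol_prefix_pred V _ μ (w μ)
  have hcan₁ : ∀ k, k ∈ Finset.range n → T k = 𝒯₁ * hol V q₁ (B.take k) := fun k hk => by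
    have hk' : k ≤ (t.flatMap (fun κ => seg κ ((w + e μ) κ))).length := by rw [hBe]; exact (Finset.mem_range.mp hk).le
    have := hol_base_prefix_nonneg V μ h (w + e μ) k hk'
    rw [hAe, hBe, hμe] at this
    simpa only [h𝒯₁, hT, hq₁] using this.symm
  have hcan₂ : ∀ k, k ∈ Finset.range n → T' k = 𝒯₁ * β⁻¹ * hol V q₂ (B.take k) := fun k hk => by
    have hk' : k ≤ (t.flatMap (fun κ => seg κ (w κ))).length := (Finset.mem_range.mp hk).le
    have := hol_base_prefix_nonneg V μ h w k hk'
    rw [← h𝒯]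
    simpa only [h𝒯₂, hT', hq₂, hA, hB] using this.symm
  -- (i) first order, canonical letters (FILE C)
  have hC := norm_lapDefect_comb_add_comm_sum_le V hV μ h hs ht w m ha hplaq
  -- (ii) localisation (FILE B′) in canonical letters: `Δ_k = T_kP₁T_k⁻¹ − T'_kP₂T'_k⁻¹`
  have hTb : ∀ k, ‖(T k : 𝔸)‖ ≤ 1 ∧ ‖(((T k)⁻¹ : 𝔸ˣ) : 𝔸)‖ ≤ 1 := fun k => hbi _ _
  have hGb : ∀ k, ‖(((T k)⁻¹ * T' k * (b k)⁻¹ : 𝔸ˣ) : 𝔸)‖ ≤ 1 ∧ ‖((((T k)⁻¹ * T' k * (b k)⁻¹)⁻¹ : 𝔸ˣ) : 𝔸)‖ ≤ 1 := fun k =>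
    bicontr_mul (bicontr_mul (bicontr_inv (hbi _ _)) (hbi _ _)) (bicontr_inv (bicontr_inv (hV _ _)))
  have hL := comm_sum_rung_sub_sum_local_le T T' P₁ P₂ b hTb hGb m n
  -- (iii) the Jacobi junk: the transport loop `G_k` is the conjugated second ladder
  have hG : ∀ k, k ∈ Finset.range n → (T k)⁻¹ * T' k * (b k)⁻¹
      = ((hol V q₁ (B.take k))⁻¹ * β⁻¹) * hol V q₂ (B.take k ++ (μ, true) :: (revWord (B.take k) ++ [(μ, false)])) * ((hol V q₁ (B.take k))⁻¹ * β⁻¹)⁻¹ := fun k hk => by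
    rw [hcan₁ k hk, hcan₂ k hk]
    simp only [hb, inv_inv, hβ]
    rw [← hq₁', ← transport_loop_eq_conj_ladder V q₂ μ (B.take k), hq₁']
    group
  -- the second ladder as a chain (for ✓ `norm_chain_sub_one_le`, ✓ `comm_chain_le`)
  set T₂ : ℕ → 𝔸ˣ := fun i => hol V q₂ (B.take i) with hT₂
  set g₂ : ℕ → 𝔸ˣ := fun i => hol V q₂ (B.take i ++ (μ, true) :: (revWord (B.take i) ++ [(μ, false)])) with hg₂
  have hT₂b : ∀ i, ‖(T₂ i : 𝔸)‖ ≤ 1 ∧ ‖(((T₂ i)⁻¹ : 𝔸ˣ) : 𝔸)‖ ≤ 1 := fun i => hbi _ _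
  have hP₂b : ∀ i, ‖(P₂ i : 𝔸)‖ ≤ 1 ∧ ‖(((P₂ i)⁻¹ : 𝔸ˣ) : 𝔸)‖ ≤ 1 := fun i => hbi _ _
  have hg₂b : ∀ i, ‖(g₂ i : 𝔸)‖ ≤ 1 ∧ ‖(((g₂ i)⁻¹ : 𝔸ˣ) : 𝔸)‖ ≤ 1 := fun i => hbi _ _
  have hg₂0 : g₂ 0 = 1 := by simp only [hg₂]; exact ladder_chain_zero V q₂ μ B
  have hg₂s : ∀ i, g₂ (i + 1) = (T₂ i * P₂ i * (T₂ i)⁻¹) * g₂ i := fun i => by simp only [hg₂, hT₂, hP₂]; exact ladder_chain_succ V q₂ μ B i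
  have hP₂a : ∀ i, ‖(P₂ i : 𝔸) - 1‖ ≤ a := fun i => hplaq _ _
  -- per-rung bounds
  have hN₂0 : ∀ i, 0 ≤ N₂ i := fun i => norm_nonneg _
  set S₂ : ℝ := ∑ i ∈ Finset.range n, N₂ i with hS₂
  have hS₂0 : 0 ≤ S₂ := Finset.sum_nonneg fun i _ => hN₂0 i
  have hS₂mono : ∀ k, k ≤ n → ∑ i ∈ Finset.range k, N₂ i ≤ S₂ := fun k hk =>
    Finset.sum_le_sum_of_subset_of_nonneg (Finset.range_mono hk) fun i _ _ => hN₂0 i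
  -- transported element at rung k of chain 1 and the canonical one of chain 2
  have hU : ∀ k, k ∈ Finset.range n → R ((hol V q₁ (B.take k))⁻¹ * β⁻¹)⁻¹ (R (T k)⁻¹ m) = R 𝒯₂⁻¹ m := fun k hk => by
    rw [← B9Eq39Adjoint.R_mul, hcan₁ k hk, h𝒯]; congr 1; group
  have hcanN₂ : ∀ i, i ∈ Finset.range n → R (T₂ i)⁻¹ (R 𝒯₂⁻¹ m) = R (T' i)⁻¹ m := fun i hi => by
    rw [← B9Eq39Adjoint.R_mul, hcan₂ i hi, ← h𝒯]; simp only [hT₂, mul_inv_rev]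
  -- ‖G_k − 1‖ ≤ k·a and N(G_k) ≤ Σ_{i<k} N₂ i
  have hG1 : ∀ k, k ∈ Finset.range n → ‖(((T k)⁻¹ * T' k * (b k)⁻¹ : 𝔸ˣ) : 𝔸) - 1‖ ≤ a * k := fun k hk => by
    rw [hG k hk]
    refine (norm_conj_sub_one_le (bicontr_mul (bicontr_inv (hbi _ _)) (bicontr_inv (hV _ _))) _).trans ?_
    have h1 := norm_chain_sub_one_le T₂ P₂ g₂ hT₂b hP₂b hg₂0 hg₂s k
    have h2 : ∑ i ∈ Finset.range k, ‖(P₂ i : 𝔸) - 1‖ ≤ ∑ i ∈ Finset.range k, a := Finset.sum_le_sum fun i _ => hP₂a i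
    rw [Finset.sum_const, Finset.card_range, nsmul_eq_mul] at h2
    simp only [hg₂] at h1
    linarith
  have hGN : ∀ k, k ∈ Finset.range n → ‖(((T k)⁻¹ * T' k * (b k)⁻¹ : 𝔸ˣ) : 𝔸) * R (T k)⁻¹ m - R (T k)⁻¹ m * (((T k)⁻¹ * T' k * (b k)⁻¹ : 𝔸ˣ) : 𝔸)‖
      ≤ ∑ i ∈ Finset.range k, N₂ i := fun k hk => by
    rw [hG k hk]
    refine (comm_conj_le (bicontr_mul (bicontr_inv (hbi _ _)) (bicontr_inv (hV _ _))) _ _).trans ?_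
    rw [hU k hk]
    have h1 := comm_chain_le T₂ P₂ g₂ hT₂b hP₂b hg₂b hg₂0 hg₂s (R 𝒯₂⁻¹ m) k
    simp only [hg₂] at h1
    refine h1.trans (Finset.sum_le_sum fun i hi => le_of_eq ?_)
    have hi' : i ∈ Finset.range n := Finset.mem_range.mpr ((Finset.mem_range.mp hi).trans (Finset.mem_range.mp hk))
    rw [hcanN₂ i hi', hN₂]
  -- ‖Q_k − 1‖ ≤ a and N(Q_k) ≤ N₂ k + 2a·Σ_{i<k} N₂ i
  have hQ1 : ∀ k, ‖((b k * P₂ k * (b k)⁻¹ : 𝔸ˣ) : 𝔸) - 1‖ ≤ a := fun k => (norm_conj_sub_one_le (bicontr_inv (hV _ _)) _).trans (hP₂a k)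
  have hQN : ∀ k, k ∈ Finset.range n → ‖((b k * P₂ k * (b k)⁻¹ : 𝔸ˣ) : 𝔸) * R (T k)⁻¹ m - R (T k)⁻¹ m * ((b k * P₂ k * (b k)⁻¹ : 𝔸ˣ) : 𝔸)‖
      ≤ N₂ k + 2 * a * ∑ i ∈ Finset.range k, N₂ i := fun k hk => by
    refine (comm_conj_le (bicontr_inv (hV _ _)) _ _).trans ?_
    refine (comm_le_comm_add _ _ (R (T' k)⁻¹ m)).trans ?_
    rw [← hN₂]
    have hdiff : ‖R (b k)⁻¹ (R (T k)⁻¹ m) - R (T' k)⁻¹ m‖ ≤ ∑ i ∈ Finset.range k, N₂ i := by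
      -- `T' = T·G·b`, so `R(T'⁻¹)m = R(b⁻¹)R(G⁻¹)R(T⁻¹)m`
      have eT' : T' k = T k * ((T k)⁻¹ * T' k * (b k)⁻¹) * b k := by group
      have e1 : R (T' k)⁻¹ m = R (b k)⁻¹ (R ((T k)⁻¹ * T' k * (b k)⁻¹)⁻¹ (R (T k)⁻¹ m)) := by
        rw [← B9Eq39Adjoint.R_mul, ← B9Eq39Adjoint.R_mul]; congr 1; rw [eT']; group
      rw [e1, ← B9Eq39Adjoint.R_sub]
      refine (norm_R_le (bicontr_inv (bicontr_inv (hV _ _))) _).trans ?_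
      rw [← norm_neg, neg_sub]
      exact (norm_R_inv_sub_self_le_comm_of_inv (hGb k).2 _).trans (hGN k hk)
    have := mul_le_mul_of_nonneg_left hdiff (by positivity : (0 : ℝ) ≤ 2 * ‖((P₂ k : 𝔸ˣ) : 𝔸) - 1‖)
    have h3 : 2 * ‖((P₂ k : 𝔸ˣ) : 𝔸) - 1‖ * ∑ i ∈ Finset.range k, N₂ i ≤ 2 * a * ∑ i ∈ Finset.range k, N₂ i :=
      mul_le_mul_of_nonneg_right (by linarith [hP₂a k]) (Finset.sum_nonneg fun i _ => hN₂0 i)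
    linarith
  -- the Jacobi sum ≤ 10·a·n·S₂
  have hJac : ∑ k ∈ Finset.range n,
      (2 * ‖(((T k)⁻¹ * T' k * (b k)⁻¹ : 𝔸ˣ) : 𝔸) - 1‖ * ‖((b k * P₂ k * (b k)⁻¹ : 𝔸ˣ) : 𝔸) * R (T k)⁻¹ m - R (T k)⁻¹ m * ((b k * P₂ k * (b k)⁻¹ : 𝔸ˣ) : 𝔸)‖
        + 2 * ‖((b k * P₂ k * (b k)⁻¹ : 𝔸ˣ) : 𝔸) - 1‖ * (1 + ‖(((T k)⁻¹ * T' k * (b k)⁻¹ : 𝔸ˣ) : 𝔸) - 1‖)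
          * ‖(((T k)⁻¹ * T' k * (b k)⁻¹ : 𝔸ˣ) : 𝔸) * R (T k)⁻¹ m - R (T k)⁻¹ m * (((T k)⁻¹ * T' k * (b k)⁻¹ : 𝔸ˣ) : 𝔸)‖)
      ≤ 10 * a * n * S₂ := by
    have step : ∀ k ∈ Finset.range n,
        2 * ‖(((T k)⁻¹ * T' k * (b k)⁻¹ : 𝔸ˣ) : 𝔸) - 1‖ * ‖((b k * P₂ k * (b k)⁻¹ : 𝔸ˣ) : 𝔸) * R (T k)⁻¹ m - R (T k)⁻¹ m * ((b k * P₂ k * (b k)⁻¹ : 𝔸ˣ) : 𝔸)‖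
          + 2 * ‖((b k * P₂ k * (b k)⁻¹ : 𝔸ˣ) : 𝔸) - 1‖ * (1 + ‖(((T k)⁻¹ * T' k * (b k)⁻¹ : 𝔸ˣ) : 𝔸) - 1‖)
            * ‖(((T k)⁻¹ * T' k * (b k)⁻¹ : 𝔸ˣ) : 𝔸) * R (T k)⁻¹ m - R (T k)⁻¹ m * (((T k)⁻¹ * T' k * (b k)⁻¹ : 𝔸ˣ) : 𝔸)‖
        ≤ 2 * (a * n) * N₂ k + (4 * (a * n) * a + 2 * a * (1 + a * n)) * S₂ := by
      intro k hk
      have hkn : (k : ℝ) ≤ n := by exact_mod_cast (Finset.mem_range.mp hk).le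
      have g1 := hG1 k hk
      have g1' : ‖(((T k)⁻¹ * T' k * (b k)⁻¹ : 𝔸ˣ) : 𝔸) - 1‖ ≤ a * n := g1.trans (mul_le_mul_of_nonneg_left hkn ha)
      have gN := (hGN k hk).trans (hS₂mono k (Finset.mem_range.mp hk).le)
      have q1 := hQ1 k
      have qN : ‖((b k * P₂ k * (b k)⁻¹ : 𝔸ˣ) : 𝔸) * R (T k)⁻¹ m - R (T k)⁻¹ m * ((b k * P₂ k * (b k)⁻¹ : 𝔸ˣ) : 𝔸)‖ ≤ N₂ k + 2 * a * S₂ := by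
        have := hQN k hk; nlinarith [hS₂mono k (Finset.mem_range.mp hk).le, ha]
      have t1 : 2 * ‖(((T k)⁻¹ * T' k * (b k)⁻¹ : 𝔸ˣ) : 𝔸) - 1‖ * ‖((b k * P₂ k * (b k)⁻¹ : 𝔸ˣ) : 𝔸) * R (T k)⁻¹ m - R (T k)⁻¹ m * ((b k * P₂ k * (b k)⁻¹ : 𝔸ˣ) : 𝔸)‖
          ≤ 2 * (a * n) * (N₂ k + 2 * a * S₂) :=
        mul_le_mul (mul_le_mul_of_nonneg_left g1' (by norm_num)) qN (norm_nonneg _) (by positivity)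
      have t2 : 2 * ‖((b k * P₂ k * (b k)⁻¹ : 𝔸ˣ) : 𝔸) - 1‖ * (1 + ‖(((T k)⁻¹ * T' k * (b k)⁻¹ : 𝔸ˣ) : 𝔸) - 1‖)
            * ‖(((T k)⁻¹ * T' k * (b k)⁻¹ : 𝔸ˣ) : 𝔸) * R (T k)⁻¹ m - R (T k)⁻¹ m * (((T k)⁻¹ * T' k * (b k)⁻¹ : 𝔸ˣ) : 𝔸)‖
          ≤ 2 * a * (1 + a * n) * S₂ :=
        mul_le_mul (mul_le_mul (mul_le_mul_of_nonneg_left q1 (by norm_num)) (by linarith) (by positivity) (by positivity)) gN (norm_nonneg _) (by positivity)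
      nlinarith [t1, t2, hN₂0 k]
    refine (Finset.sum_le_sum step).trans ?_
    rw [Finset.sum_add_distrib, ← Finset.mul_sum, ← hS₂, Finset.sum_const, Finset.card_range, nsmul_eq_mul]
    have han' : a * n ≤ 1 := by rw [hn, hB]; exact han
    have hn0 : (0 : ℝ) ≤ n := Nat.cast_nonneg _
    have han0 : 0 ≤ a * n := mul_nonneg ha hn0
    have hsq : (a * n) * (a * n) ≤ a * n := by nlinarith
    have hsq' := mul_le_mul_of_nonneg_right hsq hS₂0
    have h4 := mul_le_mul_of_nonneg_right han' hS₂0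
    nlinarith [hsq', h4, hS₂0, han0, mul_nonneg han0 hS₂0]
  -- (iv) assemble
  have hL' := hL.trans hJac
  -- the k-sums of FILE C and of FILE B′ are the same `Σ_k Δ_k`
  have eΔ : ∀ k, (((T k * P₁ k * (T k)⁻¹ : 𝔸ˣ) : 𝔸) - ((T' k * P₂ k * (T' k)⁻¹ : 𝔸ˣ) : 𝔸)) = R (T k) (P₁ k : 𝔸) - R (T' k) (P₂ k : 𝔸) := fun k => by
    simp only [R_def, Units.val_mul]
  simp only [eΔ] at hL'
  set E : 𝔸 := (2 : ℕ) • m - R (hol V 0 (contour27 0 w μ))⁻¹ m - R (hol V 0 (contour27 0 (w + e μ) μ)) m with hE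
  set ZD : 𝔸 := (∑ k ∈ Finset.range n, (R (T k) (P₁ k : 𝔸) - R (T' k) (P₂ k : 𝔸))) * m - m * ∑ k ∈ Finset.range n, (R (T k) (P₁ k : 𝔸) - R (T' k) (P₂ k : 𝔸)) with hZD
  set ZL : 𝔸 := (∑ k ∈ Finset.range n, (T k : 𝔸) * ((P₁ k : 𝔸) - ((b k * P₂ k * (b k)⁻¹ : 𝔸ˣ) : 𝔸)) * (((T k)⁻¹ : 𝔸ˣ) : 𝔸)) * m
      - m * ∑ k ∈ Finset.range n, (T k : 𝔸) * ((P₁ k : 𝔸) - ((b k * P₂ k * (b k)⁻¹ : 𝔸ˣ) : 𝔸)) * (((T k)⁻¹ : 𝔸ˣ) : 𝔸) with hZL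
  have e : E + ZL = (E + ZD) - (ZD - ZL) := by abel
  have hS₁0 : 0 ≤ ∑ k ∈ Finset.range n, N₁ k := Finset.sum_nonneg fun k _ => norm_nonneg _
  have hC' : ‖E + ZD‖ ≤ 5 * a * n * ((∑ k ∈ Finset.range n, N₁ k) + S₂) := by
    simpa only [hE, hZD, hT, hT', hP₁, hP₂, hN₁, hN₂, hS₂, hn, hq₁, hq₂, hA, hB] using hC
  calc ‖E + ZL‖ = ‖(E + ZD) - (ZD - ZL)‖ := by rw [e]
    _ ≤ ‖E + ZD‖ + ‖ZD - ZL‖ := norm_sub_le _ _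
    _ ≤ 5 * a * n * ((∑ k ∈ Finset.range n, N₁ k) + S₂) + 10 * a * n * S₂ := add_le_add hC' hL'
    _ ≤ 15 * a * n * ((∑ k ∈ Finset.range n, N₁ k) + S₂) := by
        have hn0 : (0 : ℝ) ≤ n := Nat.cast_nonneg _
        have h1 : 0 ≤ 10 * a * n * ∑ k ∈ Finset.range n, N₁ k := by positivity
        linarith

end Normed

end Summit.QuantumFields.YangMills.Theorems.Prop7LapCombLocal

end
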